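import Summits.BirchSwinnertonDyer.BirchSwinnertonDyer.Theorems.PrintCf2DisegniPairTwoCompanionValueChi8
import Literature.NumberTheory.EllipticCurves.Disegni2017.BaseChangeDirichletSplitValuesProofs
import Literature.NumberTheory.EllipticCurves.PAdicHeightsLogProofs
import HarnessLib

/-!
# Road (C) `disegni-pair-two` on crux stmt-BirchSwinnertonDyer-20368 — the quotient law DESCENDS TO `ℚ₂`
# and becomes an INTEGER VALUATION EQUATION

Cell `bsd-print-cf2` (`run/shared/lean/pub/bsd-print-cf2/`), width seat `bsd-line-cf2-p1-w8` g23; sequel of the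
companion-cancellation files `…CompanionValueChi8` / `…CompanionValueChi4` / `…CompanionValueChi8Prime` (-w8 g22).
`--supports stmt-BirchSwinnertonDyer-20368` (helper). THEOREMS ONLY (no `def`, no named fact, no `sorry`);
conditional on every displayed hypothesis. BSD is not proved by any of this; no summit statement is claimed;
20368 is not closed here.

## What is proved

The companion-free quotient laws of -w8 g22 read, on the `χ₈∘N`-line (`d* = 2`),
`ι⁻¹(L′(W,1)·Z°)·h₂ = −σ₀·log₂γ·ι⁻¹(ĥ(P)·u·Ω⁺_f·τ(χ₈))·ι₂(α⁻³)·L₂′(f,−2)` in `ℂ₂`, and similarly on the odd lines.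
Substituting Disegni's interpolation factor at a primitive point (`zCirc_baseChangeDirichlet_of_isPrimitive`:
`Z° = u·(ι(α)⁻ⁿ·τ(θ⁻¹))²`, `θ⁻¹ = θ` quadratic) the local constant `u = splitLocalConstant 2`, ONE Gauss sum `τ(χ)`
and `α⁻ⁿ` CANCEL, and the law becomes

  `ι⁻¹( L′(W,1)·τ(χ)·x / (ĥ(P)·Ω^±_f) ) · h₂ = ∓σ₀ · log₂γ · αⁿ · D`     (`x = 1` resp. `i` on the odd lines).

So under the ONE archimedean rationality input `ρ := L′(W,1)·τ(χ)·x/(ĥ(P)·Ω^±_f) ∈ ℚ` (Gross–Zagier I.(7.3) + the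
period ratio `Ω_W/Ω^±_{f_V}`; a displayed hypothesis `hρ` here) the law is an identity IN `ℚ₂` — every term is a
`2`-adic number — and, with the `2`-adic height `h₂ ≠ 0` (Bertrand), an INTEGER equation of valuations:

* §1 `coe_symm_apply_coe`, ★ `quotient_law_descends` (any `p`; pure field algebra over `ι : PadicAlgCl p ≃ ℂ`):
  the displayed `ℂ_p`-identity + `hρ` ⟹ `ρ·h = s·ℓ·αⁿ·D` in `ℚ_p`;
  ★ `valuation_eq_of_rat_mul_eq` : `ρ·h = s·ℓ·αⁿ·D`, `s = ±1`, `‖α‖ = 1`, `ρ h ℓ ≠ 0` ⟹ `D ≠ 0` and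
  `v(D) + v(ℓ) = v(ρ) + v(h)`.
* §2 `norm_padicLog_cyclotomicGenerator_two` (`‖log₂ 5‖ = 1/4`), `padicLog_cyclotomicGenerator_two_ne_zero`,
  ★ `valuation_padicLog_cyclotomicGenerator_two` (`v₂(log₂ γ) = 2`, `γ = 5`).
* §3 (`d* = 2`) ★★ `quotient_law_chi8_padic` : `∃ σ = ±1, ρ·h₂ = σ·log₂γ·α³·L₂′(f,−2)` in `ℚ₂`;
  ★★ `quotient_law_chi8_valuation` : `h₂ ≠ 0 ⟹ L₂′(f,−2) ≠ 0 ∧ v₂(L₂′(f,−2)) + 2 = v₂(ρ) + v₂(h₂)`.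
* the odd lines `d* = −1` (`χ₋₄∘N`, `n = 2`, `x = i`, `Ω⁻_f`, `D = [T¹]L₂⁻(f,ω,T)`) and `d* = −2` (`χ₋₈∘N`, `n = 3`,
  `x = i`, `Ω⁻_f`, `D = L₂⁻′(f,ω,−2)`) are the sequel file `PrintCf2DisegniPairTwoQuotientLawValuationOdd.lean`.

What remains between this and the class's defect key (pen 21:04Z, v3 budget): (a) the rationality input `hρ`
= `L′(W,1) = shaAn(W)·Ω_W·Reg·Tam/tors²` (definition `shaAn`) + `GrossZagier1986_thm_I_7_3` + ONE period ratio
`Ω_W·τ(χ)·x/Ω^±_{f_V} ∈ ℚ` with its `2`-adic valuation (class constant); (b) the (Δ1) law for `v₂(D)`; (c) the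
(U5e) print stub `ChiLineGrossZagierClauses`.

References: D. Disegni, Compos. Math. 153 (2017) Thm. B [Disegni2017]; B. Perrin-Riou, Invent. Math. 89 (1987)
§1 [PerrinRiou1987]; B. Mazur, J. Tate, J. Teitelbaum, Invent. Math. 84 (1986) §I.13 [MazurTateTeitelbaum1986Invent];
F. Gouvêa, p-adic Numbers (1993) §5.7 [Gouvea1993PadicNumbers].
-/

set_option autoImplicit false
set_option linter.dupNamespace false

noncomputable section

open scoped Classical MatrixGroups ModularForm NumberField

open CongruenceSubgroup NumberField IsDedekindDomain WeierstrassCurve WeierstrassCurve.Affine.Point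
  Literature.NumberTheory.EllipticCurves Literature.NumberTheory.EllipticCurves.ModularForms
  Literature.NumberTheory.EllipticCurves.Disegni2017 Literature.NumberTheory.GaloisRepresentations
  Summit.BirchSwinnertonDyer.Rank1Residual.AdditivePotMult

namespace Summit.BirchSwinnertonDyer.BirchSwinnertonDyer.Theorems.PrintCf2.DisegniPairTwo

/-! ### §1 The descent to `ℚ_p` and the valuation equation (any `p`) -/

section Descent

variable {p : ℕ} [Fact p.Prime] (ι : PadicAlgCl p ≃+* ℂ)

/-- `ι⁻¹(ι(y)) = y` read in `ℂ_p` for a `p`-adic number `y` (the tower `ℚ_p → PadicAlgCl p → ℂ_p`). [folklore] -/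
theorem coe_symm_apply_coe (y : ℚ_[p]) :
    ((ι.symm (ι ((y : PadicAlgCl p))) : PadicAlgCl p) : ℂ_[p]) = algebraMap ℚ_[p] ℂ_[p] y := by
  rw [RingEquiv.symm_apply_apply, PadicComplex.coe_eq]
  exact (IsScalarTower.algebraMap_apply ℚ_[p] (PadicAlgCl p) ℂ_[p] y).symm

/-- ★ **The quotient law descends to `ℚ_p`.** In `ℂ_p`, with `ψ = ι⁻¹`: if
`ψ(L·(u·(ι(α)⁻ⁿ·τ)²)·x)·h = s·ℓ·ψ(ĥ·(u·Ω·τ))·α⁻ⁿ·D` (the shape of the companion-free quotient law with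
Disegni's `Z° = u·(ι(α)⁻ⁿτ)²` substituted; `h, ℓ, α, D ∈ ℚ_p`, `s ∈ ℤ`, `u ∈ ℚ`), `u, τ, x, L, α ≠ 0`, and
`L·τ·x = ρ·ĥ·Ω` for a RATIONAL `ρ`, then `ρ·h = s·ℓ·αⁿ·D` in `ℚ_p` (`u`, one `τ`, `α⁻ⁿ` cancel; `ĥ, Ω ≠ 0` follow
from `L τ x ≠ 0`). Pure field algebra. [cite: PerrinRiou1987, §1 (the quotient principle)]
[cite: Disegni2017, Theorem B (arXiv v3 PDF p. 8)] -/
theorem quotient_law_descends {L x hP Ω τ : ℂ} {u : ℚ} {α h ℓ D : ℚ_[p]} {n : ℕ} {s : ℤ}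
    (hu : u ≠ 0) (hτ : τ ≠ 0) (hx : x ≠ 0) (hL : L ≠ 0) (hα : α ≠ 0)
    (hlaw : ((ι.symm (L * ((u : ℂ) * ((ι ((α : PadicAlgCl p)))⁻¹ ^ n * τ) ^ 2) * x) : PadicAlgCl p) :
          ℂ_[p]) * algebraMap ℚ_[p] ℂ_[p] h =
      (s : ℂ_[p]) * algebraMap ℚ_[p] ℂ_[p] ℓ *
        ((ι.symm (hP * ((u : ℂ) * Ω * τ)) : PadicAlgCl p) : ℂ_[p]) *
        algebraMap ℚ_[p] ℂ_[p] (α⁻¹ ^ n) * algebraMap ℚ_[p] ℂ_[p] D)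
    (ρ : ℚ) (hρ : L * τ * x = (ρ : ℂ) * hP * Ω) :
    (ρ : ℚ_[p]) * h = (s : ℚ_[p]) * ℓ * α ^ n * D := by
  set ψ : ℂ →+* ℂ_[p] := (algebraMap (PadicAlgCl p) ℂ_[p]).comp ι.symm.toRingHom with hψ_def
  have hψ : ∀ z : ℂ, ((ι.symm z : PadicAlgCl p) : ℂ_[p]) = ψ z := fun z => rfl
  set ι₂ := algebraMap ℚ_[p] ℂ_[p] with hι₂
  have hψα : ψ (ι ((α : PadicAlgCl p))) = ι₂ α := by rw [← hψ]; exact coe_symm_apply_coe ι α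
  -- `ĥ, Ω ≠ 0` from `L τ x = ρ ĥ Ω ≠ 0`
  have hprod : (ρ : ℂ) * hP * Ω ≠ 0 := by rw [← hρ]; exact mul_ne_zero (mul_ne_zero hL hτ) hx
  have hhP : hP ≠ 0 := fun h0 => hprod (by rw [h0, mul_zero, zero_mul])
  have hΩ : Ω ≠ 0 := fun h0 => hprod (by rw [h0, mul_zero])
  -- read everything in `ℂ_p`
  have hρ' := congrArg ψ hρ
  simp only [map_mul, map_ratCast] at hρ'
  rw [hψ, hψ] at hlaw
  simp only [map_mul, map_pow, map_inv₀, hψα, map_ratCast] at hlaw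
  apply (algebraMap ℚ_[p] ℂ_[p]).injective
  simp only [map_mul, map_pow, map_ratCast, map_intCast]
  have hα' : ι₂ α ≠ 0 := (map_ne_zero ι₂).mpr hα
  have hu' : (u : ℂ_[p]) ≠ 0 := by exact_mod_cast hu
  have hτ' : ψ τ ≠ 0 := (map_ne_zero ψ).mpr hτ
  have hhP' : ψ hP ≠ 0 := (map_ne_zero ψ).mpr hhP
  have hΩ' : ψ Ω ≠ 0 := (map_ne_zero ψ).mpr hΩ
  set b : ℂ_[p] := (ι₂ α)⁻¹ with hb
  have habn : ι₂ α ^ n * b ^ n = 1 := by rw [← mul_pow, hb, mul_inv_cancel₀ hα', one_pow]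
  have key : (ψ hP * ψ Ω * (u : ℂ_[p]) * ψ τ * b ^ (2 * n)) *
      ((ρ : ℂ_[p]) * ι₂ h - (s : ℂ_[p]) * ι₂ ℓ * ι₂ α ^ n * ι₂ D) = 0 := by
    linear_combination hlaw - ((u : ℂ_[p]) * b ^ (2 * n) * ψ τ * ι₂ h) * hρ' -
      ((s : ℂ_[p]) * ι₂ ℓ * ψ hP * ψ Ω * (u : ℂ_[p]) * ψ τ * b ^ n * ι₂ D) * habn
  have hne : ψ hP * ψ Ω * (u : ℂ_[p]) * ψ τ * b ^ (2 * n) ≠ 0 :=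
    mul_ne_zero (mul_ne_zero (mul_ne_zero (mul_ne_zero hhP' hΩ') hu') hτ') (pow_ne_zero _ (inv_ne_zero hα'))
  exact sub_eq_zero.mp ((mul_eq_zero.mp key).resolve_left hne)

/-- The cast of a sign `s = ±1` has valuation `0` in `ℚ_p`. [folklore] -/
theorem valuation_intCast_units (s : ℤˣ) : (((s : ℤ) : ℚ_[p])).valuation = 0 := by
  rcases Int.units_eq_one_or s with rfl | rfl
  · simp
  · refine valuation_eq_of_norm_eq (by norm_num) (n := 0) ?_
    simp

/-- ★ **The valuation equation.** If `ρ·h = s·ℓ·αⁿ·D` in `ℚ_p` with `s = ±1`, `‖α‖ = 1` and `ρ, h, ℓ ≠ 0`, then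
`D ≠ 0` and `v(D) + v(ℓ) = v(ρ) + v(h)` (`v = Padic.valuation`, `v(ρ) = padicValRat p ρ`). [folklore] -/
theorem valuation_eq_of_rat_mul_eq {ρ : ℚ} {h ℓ α D : ℚ_[p]} {s : ℤˣ} {n : ℕ}
    (hlaw : (ρ : ℚ_[p]) * h = ((s : ℤ) : ℚ_[p]) * ℓ * α ^ n * D) (hα : ‖α‖ = 1)
    (hρ : ρ ≠ 0) (hh : h ≠ 0) (hℓ : ℓ ≠ 0) :
    D ≠ 0 ∧ D.valuation + ℓ.valuation = padicValRat p ρ + h.valuation := by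
  have hs : ((s : ℤ) : ℚ_[p]) ≠ 0 := by exact_mod_cast s.ne_zero
  have hρ' : (ρ : ℚ_[p]) ≠ 0 := by exact_mod_cast hρ
  have hα0 : α ≠ 0 := norm_pos_iff.mp (by rw [hα]; exact one_pos)
  have hD : D ≠ 0 := by
    intro hD
    rw [hD, mul_zero] at hlaw
    exact (mul_ne_zero hρ' hh) hlaw
  refine ⟨hD, ?_⟩
  have hvα : α.valuation = 0 := valuation_eq_of_norm_eq hα0 (n := 0) (by rw [hα]; simp)
  have hv := congrArg Padic.valuation hlaw
  rw [Padic.valuation_mul hρ' hh, Padic.valuation_ratCast,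
    Padic.valuation_mul (mul_ne_zero (mul_ne_zero hs hℓ) (pow_ne_zero _ hα0)) hD,
    Padic.valuation_mul (mul_ne_zero hs hℓ) (pow_ne_zero _ hα0), Padic.valuation_mul hs hℓ,
    Padic.valuation_pow, valuation_intCast_units, hvα] at hv
  linear_combination -hv

end Descent

/-! ### §2 `v₂(log₂ γ) = 2` for the cyclotomic generator `γ = 5` -/

section LogTwo

/-- **`‖log₂ 5‖ = 1/4`**: `‖1 − 5‖₂ = 1/4 < ‖2‖₂`, so the logarithm series is an isometry there
(`norm_padicLogSeries_eq`; Gouvêa Prop. 5.7.8) and `log₂ γ = log₂ 5` has norm `‖4‖₂`.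
[cite: Gouvea1993PadicNumbers, §5.7 Prop. 5.7.8 (PDF p. 124)] [cite: MazurTateTeitelbaum1986Invent, §I.13] -/
theorem norm_padicLog_cyclotomicGenerator_two :
    ‖padicLog 2 (cyclotomicGenerator 2 : ℚ_[2])‖ = 4⁻¹ := by
  rw [cyclotomicGenerator_two]
  have h15 : ‖(1 : ℚ_[2]) - ((5 : ℕ) : ℚ_[2])‖ = 4⁻¹ := by
    rw [show (1 : ℚ_[2]) - ((5 : ℕ) : ℚ_[2]) = -(((2 : ℕ) : ℚ_[2]) ^ 2) by push_cast; norm_num, norm_neg,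
      norm_pow, Padic.norm_p]
    norm_num
  have h2 : ‖(2 : ℚ_[2])‖ = 2⁻¹ := by
    rw [show (2 : ℚ_[2]) = ((2 : ℕ) : ℚ_[2]) by norm_num, Padic.norm_p]; norm_num
  have hlt : ‖(1 : ℚ_[2]) - ((5 : ℕ) : ℚ_[2])‖ < ‖(2 : ℚ_[2])‖ := by rw [h15, h2]; norm_num
  have hlt1 : ‖(1 : ℚ_[2]) - ((5 : ℕ) : ℚ_[2])‖ < 1 := by rw [h15]; norm_num
  rw [padicLog_eq_padicLogSeries hlt1, norm_padicLogSeries_eq hlt, h15]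

/-- `log₂ γ ≠ 0` (`γ = 5`). [cite: MazurTateTeitelbaum1986Invent, §I.13] -/
theorem padicLog_cyclotomicGenerator_two_ne_zero : padicLog 2 (cyclotomicGenerator 2 : ℚ_[2]) ≠ 0 := by
  rw [← norm_pos_iff, norm_padicLog_cyclotomicGenerator_two]; norm_num

/-- ★ **`v₂(log₂ γ) = 2`** (`γ = cyclotomicGenerator 2 = 5`, `log₂ 5 ∈ 4ℤ₂ˣ`).
[cite: MazurTateTeitelbaum1986Invent, §I.13] [cite: Gouvea1993PadicNumbers, §5.7 Prop. 5.7.8] -/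
theorem valuation_padicLog_cyclotomicGenerator_two :
    (padicLog 2 (cyclotomicGenerator 2 : ℚ_[2])).valuation = 2 :=
  valuation_eq_of_norm_eq padicLog_cyclotomicGenerator_two_ne_zero (n := 2) (by
    rw [norm_padicLog_cyclotomicGenerator_two]; norm_num)

end LogTwo

/-! ### §3 `d* = 2`: the `χ₈∘N`-line -/

section Chi8

variable (ι : PadicAlgCl 2 ≃+* ℂ) (K : Type) [Field K] [NumberField K] [IsGalois ℚ K]

/-- ★★ **THE QUOTIENT LAW on the `χ₈∘N`-line AS AN IDENTITY IN `ℚ₂`.** Same frame and hypotheses as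
`quotient_law_chi8_companion_free`, plus the archimedean rationality input
`hρ : L′(W,1)·τ(χ₈) = ρ·ĥ(P)·Ω⁺_f` with `ρ ∈ ℚ` (Gross–Zagier I.(7.3) for the member + the period ratio
`Ω_W·τ(χ₈)/Ω⁺_{f_V} ∈ ℚ`). Conclusion: `ρ·h₂ = σ·log₂γ·α³·L₂′(f,−2)` in `ℚ₂` for a sign `σ`, where
`L₂′(f,−2) = Σ_k k[T^k]L₂(f,α)(−2)^{k−1}` and `α = unitRoot V 2`. [cite: Disegni2017, Theorem B (arXiv v3 PDF p. 8)]
[cite: PerrinRiou1987, §1] [cite: MazurTateTeitelbaum1986Invent, §I.13–I.14] -/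
theorem quotient_law_chi8_padic (h2 : Module.finrank ℚ K = 2)
    (hsplit : ((Ideal.span {(2 : ℤ)}).primesOver (𝓞 K)).ncard = 2)
    (𝔭 𝔭' : HeightOneSpectrum (𝓞 K)) (h𝔭 : ((2 : ℕ) : 𝓞 K) ∈ 𝔭.asIdeal)
    (h𝔭' : ((2 : ℕ) : 𝓞 K) ∈ 𝔭'.asIdeal)
    (κ : DirichletCharacter ℂ (NumberField.discr K).natAbs)
    (hκ : ∀ ℓ : ℕ, ℓ.Prime → ℓ ≠ 2 → κ ℓ = (jacobiSym (NumberField.discr K) ℓ : ℂ))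
    (hκ2 : κ 2 = if NumberField.discr K % 8 = 1 then 1
        else if NumberField.discr K % 8 = 5 then -1 else 0)
    (hd : Nat.Coprime 2 (NumberField.discr K).natAbs)
    -- the good pair
    (V V' : WeierstrassCurve ℚ) [V.IsElliptic] [V.IsGloballyMinimal] [V'.IsElliptic] [V'.IsGloballyMinimal]
    (hordV : IsOrdinaryAt V 2) (hordV' : IsOrdinaryAt V' 2) (hap : V'.frobeniusTrace 2 = V.frobeniusTrace 2)
    {N N' : ℕ} [NeZero N] [NeZero N'] (hN : ¬ 2 ∣ N) {f : CuspForm (Gamma0 N) 2}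
    {f' : CuspForm (Gamma0 N') 2} (hfV : IsNewformOf V f) (hfV' : IsNewformOf V' f')
    (hV' : ∀ n : ℕ, cuspCoeff f' n = κ (n : ZMod _) * cuspCoeff f n)
    (h0 : HasSum (fun k : ℕ ↦ PowerSeries.coeff k (padicLFunction f (unitRoot V 2 : ℚ_[2])) *
      (-2 : ℚ_[2]) ^ k) 0)
    -- the member and its companion (archimedean side)
    (hmod : hasEntireLFunction_rat) {M M' : ℕ} [NeZero M] [NeZero M']
    {g : CuspForm (Gamma0 M) 2} {g' : CuspForm (Gamma0 M') 2}
    (W W' : WeierstrassCurve ℚ) [W.IsElliptic] [W'.IsElliptic]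
    (hg : IsNewformOf W g) (hg' : IsNewformOf W' g')
    (hgε : ∀ m : ℕ, cuspCoeff g m = (ZMod.χ₈.ringHomComp (Int.castRingHom ℂ)) m * cuspCoeff f m)
    (hg'ε : ∀ m : ℕ, cuspCoeff g' m = (ZMod.χ₈.ringHomComp (Int.castRingHom ℂ)) m * cuspCoeff f' m)
    (hW1 : W.entireLFunction 1 = 0) (hL : deriv W.entireLFunction 1 ≠ 0) (hL' : W'.entireLFunction 1 ≠ 0)
    -- the tower frame and the sign character
    {H : Type} [Field H] [NumberField H] [Algebra K H] (hKH : Module.finrank K H = 2) {t : H}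
    (htK : t ∉ Set.range (algebraMap K H)) (ht2 : t ^ 2 = algebraMap ℚ H 2)
    (G : Subgroup (H ≃ₐ[ℚ] H)) (χ : G →* ℂˣ) (s : G → ℤ) (hs : ∀ σ, ((χ σ : ℂˣ) : ℂ) = (s σ : ℂ))
    (τ : H ≃ₐ[ℚ] H) (hτG : τ ∈ G) (hsτ : s ⟨τ, hτG⟩ = -1)
    (hτK : ∀ a : K, τ (algebraMap K H a) = algebraMap K H a) (hτt : τ t = -t)
    {u : K} {e : ℚ} (hu : u ∉ Set.range (algebraMap ℚ K)) (hue : u ^ 2 = algebraMap ℚ K e)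
    (c : K ≃ₐ[ℚ] K) (hcu : c u = -u)
    -- the member's Mordell–Weil data
    [(V.quadraticTwist 2).IsElliptic] {P : (V.quadraticTwist 2).toAffine.Point}
    (hgen : ∀ R : (V.quadraticTwist 2).toAffine.Point,
      ∃ (k : ℤ) (T : (V.quadraticTwist 2).toAffine.Point), IsOfFinAddOrder T ∧ R = k • P + T)
    (htors : ∀ Q : ((V.quadraticTwist 2).quadraticTwist e).toAffine.Point, IsOfFinAddOrder Q)
    -- Disegni's datum: invariance, PIN, and the conjoined clauses (PRINT stub of the road)
    (DH : PAdicHeightDataK V 2 H)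
    (hDH : ∀ (σ : G) (a b : (V.baseChange H).toAffine.Point),
      DH.pairing (pointGalHom V H σ.1 a) (pointGalHom V H σ.1 b) = DH.pairing a b)
    {h₂ : ℚ_[2]}
    (hpin : DH.pairing
      (twistPointEquivOver V (not_mem_range_rat_of_not_mem_range htK) ht2
        (QuadraticDescent.incl H (V.quadraticTwist 2) P))
      (twistPointEquivOver V (not_mem_range_rat_of_not_mem_range htK) ht2
        (QuadraticDescent.incl H (V.quadraticTwist 2) P)) = h₂)
    (hGZ : ChiLineGrossZagierClauses ι K V H f (ι (((unitRoot V 2 : ℚ_[2]) : PadicAlgCl 2)))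
      (baseChangeDirichlet K (ZMod.χ₈.ringHomComp (Int.castRingHom ℂ))) 𝔭 𝔭' G χ DH)
    -- the archimedean rationality input (GZ86 + period ratio)
    (ρ : ℚ) (hρ : deriv W.entireLFunction 1 *
      gaussSum (ZMod.χ₈.ringHomComp (Int.castRingHom ℂ)) (ZMod.stdAddChar (N := 8)) =
        (ρ : ℂ) * (canonicalHeight P : ℂ) * (plusPeriod f : ℂ)) :
    ∃ σ : ℤˣ, (ρ : ℚ_[2]) * h₂ =
      ((σ : ℤ) : ℚ_[2]) * padicLog 2 (cyclotomicGenerator 2) * (unitRoot V 2 : ℚ_[2]) ^ 3 *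
        (∑' k : ℕ, PowerSeries.coeff k (padicLFunction f (unitRoot V 2 : ℚ_[2])) *
            (k : ℚ_[2]) * (-2) ^ (k - 1)) := by
  haveI : NeZero (2 ^ 3) := ⟨by norm_num⟩
  obtain ⟨σ₀, hlaw⟩ := quotient_law_chi8_companion_free ι K h2 hsplit 𝔭 𝔭' h𝔭 h𝔭' κ hκ hκ2 hd V V' hordV
    hordV' hap hN hfV hfV' hV' h0 hmod W W' hg hg' hgε hg'ε hW1 hL hL' hKH htK ht2 G χ s hs τ hτG hsτ hτK hτt
    hu hue c hcu hgen htors DH hDH hpin hGZ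
  -- Disegni's interpolation factor at the primitive point `χ₈`: `Z° = u·(ι(α)⁻³·τ(χ₈))²`
  have hZ : zCirc (p := 2) (ι (((unitRoot V 2 : ℚ_[2]) : PadicAlgCl 2))) N
      (baseChangeDirichlet K (ZMod.χ₈.ringHomComp (Int.castRingHom ℂ))) 𝔭 𝔭' =
      (splitLocalConstant 2 : ℂ) * ((ι (((unitRoot V 2 : ℚ_[2]) : PadicAlgCl 2)))⁻¹ ^ 3 *
        gaussSum (ZMod.χ₈.ringHomComp (Int.castRingHom ℂ))⁻¹ (ZMod.stdAddChar (N := 8))) ^ 2 :=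
    zCirc_baseChangeDirichlet_of_isPrimitive (p := 2) (K := K) h2 hsplit (n := 3) (by norm_num)
      (θ := (ZMod.χ₈.ringHomComp (Int.castRingHom ℂ) : DirichletCharacter ℂ (2 ^ 3)))
      (isPrimitive_χ₈_ringHomComp_of_charZero ℂ) _ N 𝔭 𝔭' h𝔭 h𝔭'
  rw [isQuadratic_χ₈_ringHomComp.inv] at hZ
  rw [hZ] at hlaw
  -- non-vanishing of the cancelled constants
  have hτ8 : gaussSum (ZMod.χ₈.ringHomComp (Int.castRingHom ℂ)) (ZMod.stdAddChar (N := 8)) ≠ 0 :=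
    gaussSum_stdAddChar_ne_zero isPrimitive_χ₈_ringHomComp
  have hα0 : (unitRoot V 2 : ℚ_[2]) ≠ 0 := (unitRoot_coe_spec (W := V) hordV).2.2
  refine ⟨-σ₀, ?_⟩
  have hcore := quotient_law_descends ι (p := 2) (L := deriv W.entireLFunction 1) (x := 1)
    (hP := (canonicalHeight P : ℂ)) (Ω := (plusPeriod f : ℂ))
    (τ := gaussSum (ZMod.χ₈.ringHomComp (Int.castRingHom ℂ)) (ZMod.stdAddChar (N := 8)))
    (u := splitLocalConstant 2) (α := (unitRoot V 2 : ℚ_[2])) (h := h₂)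
    (ℓ := padicLog 2 (cyclotomicGenerator 2)) (n := 3) (s := -(σ₀ : ℤ))
    (D := ∑' k : ℕ, PowerSeries.coeff k (padicLFunction f (unitRoot V 2 : ℚ_[2])) * (k : ℚ_[2]) *
      (-2) ^ (k - 1))
    (splitLocalConstant_ne_zero 2) hτ8 one_ne_zero hL hα0 (by
      rw [mul_one, Int.cast_neg]
      simpa only [mul_assoc] using hlaw) ρ (by rw [mul_one]; exact hρ)
  rw [hcore, Units.val_neg]

/-- ★★ **THE VALUATION EQUATION on the `χ₈∘N`-line** (`d* = 2`): under the hypotheses of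
`quotient_law_chi8_padic` and `h₂ ≠ 0` (Bertrand's non-degeneracy of the `2`-adic height at the member's
generator), `L₂′(f,−2) ≠ 0` and `v₂(L₂′(f,−2)) + 2 = v₂(ρ) + v₂(h₂)` — an INTEGER equation (`v₂(log₂γ) = 2`,
`v₂(α) = 0`). With (Δ1) for `v₂(L₂′(f,−2))` and the valuation of the rational `ρ = L′(W,1)τ(χ₈)/(ĥ(P)Ω⁺_f)`
(`shaAn`·Tam/tors² bookkeeping + period ratio) this is the class's defect key.
[cite: Disegni2017, Theorem B] [cite: PerrinRiou1987, §1] [cite: MazurTateTeitelbaum1986Invent, §I.13] -/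
theorem quotient_law_chi8_valuation (h2 : Module.finrank ℚ K = 2)
    (hsplit : ((Ideal.span {(2 : ℤ)}).primesOver (𝓞 K)).ncard = 2)
    (𝔭 𝔭' : HeightOneSpectrum (𝓞 K)) (h𝔭 : ((2 : ℕ) : 𝓞 K) ∈ 𝔭.asIdeal)
    (h𝔭' : ((2 : ℕ) : 𝓞 K) ∈ 𝔭'.asIdeal)
    (κ : DirichletCharacter ℂ (NumberField.discr K).natAbs)
    (hκ : ∀ ℓ : ℕ, ℓ.Prime → ℓ ≠ 2 → κ ℓ = (jacobiSym (NumberField.discr K) ℓ : ℂ))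
    (hκ2 : κ 2 = if NumberField.discr K % 8 = 1 then 1
        else if NumberField.discr K % 8 = 5 then -1 else 0)
    (hd : Nat.Coprime 2 (NumberField.discr K).natAbs)
    (V V' : WeierstrassCurve ℚ) [V.IsElliptic] [V.IsGloballyMinimal] [V'.IsElliptic] [V'.IsGloballyMinimal]
    (hordV : IsOrdinaryAt V 2) (hordV' : IsOrdinaryAt V' 2) (hap : V'.frobeniusTrace 2 = V.frobeniusTrace 2)
    {N N' : ℕ} [NeZero N] [NeZero N'] (hN : ¬ 2 ∣ N) {f : CuspForm (Gamma0 N) 2}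
    {f' : CuspForm (Gamma0 N') 2} (hfV : IsNewformOf V f) (hfV' : IsNewformOf V' f')
    (hV' : ∀ n : ℕ, cuspCoeff f' n = κ (n : ZMod _) * cuspCoeff f n)
    (h0 : HasSum (fun k : ℕ ↦ PowerSeries.coeff k (padicLFunction f (unitRoot V 2 : ℚ_[2])) *
      (-2 : ℚ_[2]) ^ k) 0)
    (hmod : hasEntireLFunction_rat) {M M' : ℕ} [NeZero M] [NeZero M']
    {g : CuspForm (Gamma0 M) 2} {g' : CuspForm (Gamma0 M') 2}
    (W W' : WeierstrassCurve ℚ) [W.IsElliptic] [W'.IsElliptic]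
    (hg : IsNewformOf W g) (hg' : IsNewformOf W' g')
    (hgε : ∀ m : ℕ, cuspCoeff g m = (ZMod.χ₈.ringHomComp (Int.castRingHom ℂ)) m * cuspCoeff f m)
    (hg'ε : ∀ m : ℕ, cuspCoeff g' m = (ZMod.χ₈.ringHomComp (Int.castRingHom ℂ)) m * cuspCoeff f' m)
    (hW1 : W.entireLFunction 1 = 0) (hL : deriv W.entireLFunction 1 ≠ 0) (hL' : W'.entireLFunction 1 ≠ 0)
    {H : Type} [Field H] [NumberField H] [Algebra K H] (hKH : Module.finrank K H = 2) {t : H}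
    (htK : t ∉ Set.range (algebraMap K H)) (ht2 : t ^ 2 = algebraMap ℚ H 2)
    (G : Subgroup (H ≃ₐ[ℚ] H)) (χ : G →* ℂˣ) (s : G → ℤ) (hs : ∀ σ, ((χ σ : ℂˣ) : ℂ) = (s σ : ℂ))
    (τ : H ≃ₐ[ℚ] H) (hτG : τ ∈ G) (hsτ : s ⟨τ, hτG⟩ = -1)
    (hτK : ∀ a : K, τ (algebraMap K H a) = algebraMap K H a) (hτt : τ t = -t)
    {u : K} {e : ℚ} (hu : u ∉ Set.range (algebraMap ℚ K)) (hue : u ^ 2 = algebraMap ℚ K e)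
    (c : K ≃ₐ[ℚ] K) (hcu : c u = -u)
    [(V.quadraticTwist 2).IsElliptic] {P : (V.quadraticTwist 2).toAffine.Point}
    (hgen : ∀ R : (V.quadraticTwist 2).toAffine.Point,
      ∃ (k : ℤ) (T : (V.quadraticTwist 2).toAffine.Point), IsOfFinAddOrder T ∧ R = k • P + T)
    (htors : ∀ Q : ((V.quadraticTwist 2).quadraticTwist e).toAffine.Point, IsOfFinAddOrder Q)
    (DH : PAdicHeightDataK V 2 H)
    (hDH : ∀ (σ : G) (a b : (V.baseChange H).toAffine.Point),
      DH.pairing (pointGalHom V H σ.1 a) (pointGalHom V H σ.1 b) = DH.pairing a b)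
    {h₂ : ℚ_[2]}
    (hpin : DH.pairing
      (twistPointEquivOver V (not_mem_range_rat_of_not_mem_range htK) ht2
        (QuadraticDescent.incl H (V.quadraticTwist 2) P))
      (twistPointEquivOver V (not_mem_range_rat_of_not_mem_range htK) ht2
        (QuadraticDescent.incl H (V.quadraticTwist 2) P)) = h₂)
    (hGZ : ChiLineGrossZagierClauses ι K V H f (ι (((unitRoot V 2 : ℚ_[2]) : PadicAlgCl 2)))
      (baseChangeDirichlet K (ZMod.χ₈.ringHomComp (Int.castRingHom ℂ))) 𝔭 𝔭' G χ DH)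
    (ρ : ℚ) (hρ : deriv W.entireLFunction 1 *
      gaussSum (ZMod.χ₈.ringHomComp (Int.castRingHom ℂ)) (ZMod.stdAddChar (N := 8)) =
        (ρ : ℂ) * (canonicalHeight P : ℂ) * (plusPeriod f : ℂ))
    -- Bertrand: the 2-adic height of the member's generator is non-zero
    (hh₂ : h₂ ≠ 0) :
    (∑' k : ℕ, PowerSeries.coeff k (padicLFunction f (unitRoot V 2 : ℚ_[2])) * (k : ℚ_[2]) *
        (-2) ^ (k - 1)) ≠ 0 ∧
      (∑' k : ℕ, PowerSeries.coeff k (padicLFunction f (unitRoot V 2 : ℚ_[2])) * (k : ℚ_[2]) *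
          (-2) ^ (k - 1)).valuation + 2 = padicValRat 2 ρ + h₂.valuation := by
  obtain ⟨σ, hlaw⟩ := quotient_law_chi8_padic ι K h2 hsplit 𝔭 𝔭' h𝔭 h𝔭' κ hκ hκ2 hd V V' hordV hordV' hap
    hN hfV hfV' hV' h0 hmod W W' hg hg' hgε hg'ε hW1 hL hL' hKH htK ht2 G χ s hs τ hτG hsτ hτK hτt hu hue c hcu
    hgen htors DH hDH hpin hGZ ρ hρ
  have hτ8 : gaussSum (ZMod.χ₈.ringHomComp (Int.castRingHom ℂ)) (ZMod.stdAddChar (N := 8)) ≠ 0 :=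
    gaussSum_stdAddChar_ne_zero isPrimitive_χ₈_ringHomComp
  have hρ0 : ρ ≠ 0 := by
    intro hρ0
    rw [hρ0, Rat.cast_zero, zero_mul, zero_mul] at hρ
    exact (mul_ne_zero hL hτ8) hρ
  rw [← valuation_padicLog_cyclotomicGenerator_two]
  exact valuation_eq_of_rat_mul_eq hlaw (unitRoot_coe_spec (W := V) hordV).2.1 hρ0 hh₂
    padicLog_cyclotomicGenerator_two_ne_zero

end Chi8

end Summit.BirchSwinnertonDyer.BirchSwinnertonDyer.Theorems.PrintCf2.DisegniPairTwo

end
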